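import Mathlib.MeasureTheory.Integral.Prod
import Mathlib.MeasureTheory.Constructions.Pi
import Literature.Geometry.Kaehler.PoincareLemmaStarConvex
import Literature.Analysis.Calculus.ConePeriodLinear
import HarnessLib

/-!
# Cone periods are iterated radial primitives — crux HeckeEigenvalueField (stmt-Langlands-13632),
# line Sketch, stub `stub_conePeriod_succ_eq_coneOperator`

Statement.  For a `(q+1)`-form `ω` on a finite-dimensional real normed space `W`, continuous on a
convex set `X`, and points `x₀, …, x_{q+1} ∈ X`, the cone period of `ω` over the straight simplex
`[x₀, …, x_{q+1}]` (`Literature.Analysis.Calculus.conePeriod`) is the cone period, over the opposite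
face `[x₁, …, x_{q+1}]`, of the radial primitive `K_{x₀} ω`
(`Literature.Geometry.Kaehler.coneOperator`, the homotopy operator of the Poincaré lemma centred at
the first vertex):

  `conePeriod (q+1) ω x = conePeriod q (K_{x₀} ω) (x ∘ Fin.succ)`.

Proof (one Fubini).  The cone-cube satisfies `κ(x)(a, s) = (1 - a) x₀ + a κ'(s)`, `κ' = κ(x ∘ succ)`
(`coneCube_cons`), so its partial derivatives at `(a, s)` are `∂₀κ = κ'(s) - x₀` and
`∂_{j+1}κ = a ∂ⱼκ'(s)` (`fderiv_coneCube_cons_zero`, `fderiv_coneCube_cons_succ`); by multilinearity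
the integrand of the cone period at `(a, s)` is `a^q ι_{κ'(s) - x₀} ω(x₀ + a(κ'(s) - x₀))` evaluated on
the frame `(∂ⱼκ'(s))ⱼ`, i.e. the integrand `coneIntegrand x₀ ω (a, κ'(s))` of the radial homotopy
operator evaluated on the frame of `κ'` (`conePeriodIntegrand_cons`).  Splitting off the first
coordinate of the cube by the volume-preserving `MeasurableEquiv.piFinSuccAbove _ 0` and Fubini
(`setIntegral_Icc_eq_integral_cons`), the inner `da`-integral is `(K_{x₀} ω)(κ'(s))` on the frame
(evaluation commutes with the integral), and the outer integral is the cone period of `K_{x₀} ω`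
over `[x₁, …, x_{q+1}]`.

## References

* J. L. Dupont, *Simplicial de Rham cohomology and characteristic classes of flat bundles*,
  Topology 15 (1976), 233–245, §1–2. [Dupont1976]
* R. Bott, L. W. Tu, *Differential Forms in Algebraic Topology* (1982), §I.4. [BottTu1982Forms]
-/

set_option linter.dupNamespace false -- project-wide: `Summit.Langlands.Langlands` is the mandated namespace

noncomputable section

open Set MeasureTheory
open Literature.Geometry.Kaehler Literature.Analysis.Calculus

namespace Summit.Langlands.Langlands.Theorems.HeckeEigenvalueField.Res

section Helpers

variable {W : Type*} [NormedAddCommGroup W] [NormedSpace ℝ W]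
  {F : Type*} [NormedAddCommGroup F] [NormedSpace ℝ F]

/-- Moving from `(a, s)` along the first coordinate direction: `cons a s + σ e₀ = cons (a + σ) s`.
[folklore] -/
theorem cons_add_smul_single_zero {q : ℕ} (a : ℝ) (s : Fin q → ℝ) (σ : ℝ) :
    (Fin.cons a s : Fin (q + 1) → ℝ) + σ • Pi.single 0 1 = Fin.cons (a + σ) s := by
  funext l
  refine Fin.cases ?_ (fun l => ?_) l
  · simp
  · simp

/-- Moving from `(a, s)` along the direction `e_{j+1}`: `cons a s + σ e_{j+1} = cons a (s + σ eⱼ)`.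
[folklore] -/
theorem cons_add_smul_single_succ {q : ℕ} (a : ℝ) (s : Fin q → ℝ) (j : Fin q) (σ : ℝ) :
    (Fin.cons a s : Fin (q + 1) → ℝ) + σ • Pi.single j.succ 1 =
      Fin.cons a (s + σ • Pi.single j 1 : Fin q → ℝ) := by
  have h := insertNth_add_smul_single q 0 a s j σ
  rwa [Fin.insertNth_zero', Fin.insertNth_zero', Fin.succAbove_zero] at h

/-- **First partial derivative of the cone-cube**: `∂₀ κ(x)(a, s) = κ(x ∘ succ)(s) - x₀`.
[cite: Dupont1976, §1] -/
theorem fderiv_coneCube_cons_zero (q : ℕ) (x : Fin (q + 2) → W) (a : ℝ) (s : Fin q → ℝ) :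
    fderiv ℝ (coneCube (q + 1) x) (Fin.cons a s) (Pi.single 0 1) =
      coneCube q (fun i => x i.succ) s - x 0 := by
  rw [fderiv_apply_eq_deriv_line (differentiable_coneCube _ _)]
  simp only [cons_add_smul_single_zero, coneCube_cons]
  set y : W := coneCube q (fun i => x i.succ) s
  have hfun : (fun σ : ℝ => (1 - (a + σ)) • x 0 + (a + σ) • y) =
      fun σ : ℝ => ((1 - a) • x 0 + a • y) + σ • (y - x 0) := by
    funext σ
    module
  have h : HasDerivAt (fun σ : ℝ => ((1 - a) • x 0 + a • y) + σ • (y - x 0)) (y - x 0) 0 := by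
    simpa using ((hasDerivAt_id (0 : ℝ)).smul_const (y - x 0)).const_add ((1 - a) • x 0 + a • y)
  rw [hfun]
  exact h.deriv

/-- **Later partial derivatives of the cone-cube**: `∂_{j+1} κ(x)(a, s) = a ∂ⱼ κ(x ∘ succ)(s)`.
[cite: Dupont1976, §1] -/
theorem fderiv_coneCube_cons_succ (q : ℕ) (x : Fin (q + 2) → W) (a : ℝ) (s : Fin q → ℝ)
    (j : Fin q) :
    fderiv ℝ (coneCube (q + 1) x) (Fin.cons a s) (Pi.single j.succ 1) =
      a • fderiv ℝ (coneCube q (fun i => x i.succ)) s (Pi.single j 1) := by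
  rw [fderiv_apply_eq_deriv_line (differentiable_coneCube _ _),
    fderiv_apply_eq_deriv_line (differentiable_coneCube _ _)]
  simp only [cons_add_smul_single_succ, coneCube_cons]
  rw [deriv_const_add, deriv_fun_const_smul_field]

/-- **The integrand of a cone period at `(a, s)` is the integrand of the radial homotopy operator
at `(a, κ'(s))` on the frame of `κ' = κ(x ∘ succ)`**:
`ω(κ(a,s))(∂₀κ, …, ∂_q κ) = a^q ι_{κ'(s) - x₀} ω(x₀ + a (κ'(s) - x₀)) (∂₀κ', …, ∂_{q-1}κ')`.
[cite: Dupont1976, §1–2] [cite: BottTu1982Forms, §I.4] -/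
theorem conePeriodIntegrand_cons (q : ℕ) (ω : W → W [⋀^Fin (q + 1)]→L[ℝ] F)
    (x : Fin (q + 2) → W) (a : ℝ) (s : Fin q → ℝ) :
    ω (coneCube (q + 1) x (Fin.cons a s))
        (fun j => fderiv ℝ (coneCube (q + 1) x) (Fin.cons a s) (Pi.single j 1)) =
      coneIntegrand (x 0) ω (a, coneCube q (fun i => x i.succ) s)
        (fun j => fderiv ℝ (coneCube q (fun i => x i.succ)) s (Pi.single j 1)) := by
  set κ' := coneCube q (fun i => x i.succ) with hκ'
  have hv : (fun j => fderiv ℝ (coneCube (q + 1) x) (Fin.cons a s) (Pi.single j 1)) =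
      Fin.cons (κ' s - x 0) (fun j => a • fderiv ℝ κ' s (Pi.single j 1)) := by
    funext j
    refine Fin.cases ?_ (fun j => ?_) j
    · rw [Fin.cons_zero]
      exact fderiv_coneCube_cons_zero q x a s
    · rw [Fin.cons_succ]
      exact fderiv_coneCube_cons_succ q x a s j
  have hpt : (1 - a) • x 0 + a • κ' s = x 0 + a • (κ' s - x 0) := by module
  rw [hv, coneCube_cons, hpt]
  have key := ((ω (x 0 + a • (κ' s - x 0))).curryLeft (κ' s - x 0)).map_smul_univ
    (fun _ => a) (fun j => fderiv ℝ κ' s (Pi.single j 1))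
  simp only [ContinuousAlternatingMap.curryLeft_apply_apply, Finset.prod_const, Finset.card_univ,
    Fintype.card_fin] at key
  simp only [coneIntegrand, ContinuousAlternatingMap.smul_apply,
    ContinuousAlternatingMap.curryLeft_apply_apply]
  exact key

/-- Membership of `cons a s` in the unit cube splits into the two factors. [folklore] -/
theorem cons_mem_Icc_iff {q : ℕ} (a : ℝ) (s : Fin q → ℝ) :
    (Fin.cons a s : Fin (q + 1) → ℝ) ∈ Icc (0 : Fin (q + 1) → ℝ) 1 ↔
      a ∈ Icc (0 : ℝ) 1 ∧ s ∈ Icc (0 : Fin q → ℝ) 1 := by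
  simp only [mem_Icc, Fin.le_cons, Fin.cons_le, Pi.zero_apply, Pi.one_apply]
  have h0 : Fin.tail (0 : Fin (q + 1) → ℝ) = 0 := rfl
  have h1 : Fin.tail (1 : Fin (q + 1) → ℝ) = 1 := rfl
  rw [h0, h1]
  tauto

/-- **Fubini on the unit cube, first coordinate innermost**: for `f` integrable on `[0,1]^{q+1}`,
`∫_{[0,1]^{q+1}} f = ∫_{s ∈ [0,1]^q} ∫_{a ∈ [0,1]} f(a, s)` (the coordinate split
`MeasurableEquiv.piFinSuccAbove _ 0` is volume preserving). [folklore] -/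
theorem setIntegral_Icc_eq_integral_cons {G : Type*} [NormedAddCommGroup G] [NormedSpace ℝ G]
    {q : ℕ} (f : (Fin (q + 1) → ℝ) → G) (hf : IntegrableOn f (Icc 0 1) volume) :
    ∫ t in Icc (0 : Fin (q + 1) → ℝ) 1, f t =
      ∫ s in Icc (0 : Fin q → ℝ) 1, ∫ a in Icc (0 : ℝ) 1, f (Fin.cons a s) := by
  set e := MeasurableEquiv.piFinSuccAbove (fun _ : Fin (q + 1) => ℝ) 0 with he
  have hemp : MeasurePreserving e volume volume :=
    volume_preserving_piFinSuccAbove (fun _ : Fin (q + 1) => ℝ) 0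
  have hsymm : MeasurePreserving e.symm (volume : Measure (ℝ × (Fin q → ℝ))) volume := hemp.symm e
  have hes : ∀ p : ℝ × (Fin q → ℝ), e.symm p = Fin.cons p.1 p.2 := fun p =>
    Fin.insertNth_zero' p.1 p.2
  have hpre : e.symm ⁻¹' Icc (0 : Fin (q + 1) → ℝ) 1 = Icc (0 : ℝ) 1 ×ˢ Icc (0 : Fin q → ℝ) 1 := by
    ext p
    rw [mem_preimage, hes, cons_mem_Icc_iff, mem_prod]
  have h1 : ∫ t in Icc (0 : Fin (q + 1) → ℝ) 1, f t =
      ∫ p in Icc (0 : ℝ) 1 ×ˢ Icc (0 : Fin q → ℝ) 1, f (Fin.cons p.1 p.2) := by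
    rw [← hsymm.setIntegral_preimage_emb e.symm.measurableEmbedding f (Icc 0 1), hpre]
    simp only [hes]
  have hint : IntegrableOn (fun p : ℝ × (Fin q → ℝ) => f (Fin.cons p.1 p.2))
      (Icc (0 : ℝ) 1 ×ˢ Icc (0 : Fin q → ℝ) 1) volume := by
    have h := (hsymm.integrableOn_comp_preimage e.symm.measurableEmbedding (f := f)
      (s := Icc 0 1)).2 hf
    rw [hpre] at h
    exact h.congr_fun (fun p _ => by simp only [Function.comp_apply, hes])
      (measurableSet_Icc.prod measurableSet_Icc)
  rw [h1, Measure.volume_eq_prod, ← Measure.prod_restrict]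
  rw [IntegrableOn, Measure.volume_eq_prod, ← Measure.prod_restrict] at hint
  exact integral_prod_symm _ hint

/-- The integrand `a ↦ a^q ι_{y - x₀} ω(x₀ + a (y - x₀))` of the radial homotopy operator is
continuous on `[0, 1]` when `ω` is continuous on a convex set containing `x₀` and `y`. [folklore] -/
theorem continuousOn_coneIntegrand_Icc {X : Set W} (hXc : Convex ℝ X) {q : ℕ}
    {ω : W → W [⋀^Fin (q + 1)]→L[ℝ] F} (hω : ContinuousOn ω X) {x₀ y : W} (hx₀ : x₀ ∈ X)
    (hy : y ∈ X) :
    ContinuousOn (fun a : ℝ => coneIntegrand x₀ ω (a, y)) (Icc 0 1) := by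
  have hγc : Continuous fun a : ℝ => x₀ + a • (y - x₀) := by fun_prop
  have hγ : ContinuousOn (fun a : ℝ => ω (x₀ + a • (y - x₀))) (Icc 0 1) :=
    hω.comp hγc.continuousOn fun a ha => hXc.add_smul_sub_mem hx₀ hy ha
  have h2 : ContinuousOn (fun a : ℝ => (ω (x₀ + a • (y - x₀))).curryLeft (y - x₀)) (Icc 0 1) :=
    ((ContinuousAlternatingMap.curryLeftLI (𝕜 := ℝ) (E := W) (F := F)
      (n := q)).continuous.comp_continuousOn hγ).clm_apply continuousOn_const
  have h3 : ContinuousOn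
      (fun a : ℝ => (a ^ q) • (ω (x₀ + a • (y - x₀))).curryLeft (y - x₀)) (Icc 0 1) :=
    ContinuousOn.smul (continuousOn_pow q) h2
  simpa only [coneIntegrand] using h3

end Helpers

/-- **Stub CP-REC — cone periods are iterated radial primitives.**  The cone period of a
`(q+1)`-form over the straight simplex `[x₀, …, x_{q+1}]` is the cone period, over the opposite face
`[x₁, …, x_{q+1}]`, of its radial primitive centred at the first vertex:
`conePeriod (q+1) ω x = conePeriod q (K_{x₀} ω) (x ∘ succ)` — one Fubini on
`[0,1]^{q+1} = [0,1] × [0,1]^q` for the cone-cube `κ(x)(t₀, t') = x₀ + t₀ (κ(x ∘ succ)(t') - x₀)`, whose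
partial derivatives are `∂₀κ = κ' - x₀` and `∂_{j+1}κ = t₀ ∂_j κ'`.  By induction the homogeneous cone
cochain of the line is `(K_{γ_q x₀} ⋯ K_{γ₀ x₀} ω)(γ_{q+1} x₀)`, the bottom corner of the double-complex
staircase. [cite: Dupont1976, §1–2] [cite: BottTu1982Forms, §I.4] -/
theorem stub_conePeriod_succ_eq_coneOperator
    {W : Type*} [NormedAddCommGroup W] [NormedSpace ℝ W] [FiniteDimensional ℝ W]
    {F : Type*} [NormedAddCommGroup F] [NormedSpace ℝ F] [CompleteSpace F]
    {X : Set W} (hXc : Convex ℝ X) (q : ℕ) (ω : W → W [⋀^Fin (q + 1)]→L[ℝ] F)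
    (hω : ContinuousOn ω X) (x : Fin (q + 2) → W) (hx : ∀ i, x i ∈ X) :
    conePeriod (q + 1) ω x = conePeriod q (coneOperator (x 0) ω) (fun j => x j.succ) := by
  rw [conePeriod_def, conePeriod_def,
    setIntegral_Icc_eq_integral_cons _ (integrableOn_conePeriodIntegrand hXc (q + 1) hω hx)]
  refine setIntegral_congr_fun measurableSet_Icc fun s hs => ?_
  simp only [conePeriodIntegrand_cons]
  have hsX : coneCube q (fun i => x i.succ) s ∈ X :=
    coneCube_mem_of_convex hXc q (fun i => hx i.succ) fun j => ⟨hs.1 j, hs.2 j⟩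
  have hGi : IntervalIntegrable
      (fun a : ℝ => coneIntegrand (x 0) ω (a, coneCube q (fun i => x i.succ) s)) volume 0 1 :=
    (continuousOn_coneIntegrand_Icc hXc hω (hx 0) hsX).intervalIntegrable_of_Icc zero_le_one
  rw [coneOperator, intervalIntegral_apply_alternating hGi,
    intervalIntegral.integral_of_le zero_le_one, integral_Icc_eq_integral_Ioc]

end Summit.Langlands.Langlands.Theorems.HeckeEigenvalueField.Res

end
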